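import Literature.MathematicalPhysics.QuantumFieldTheory.Balaban1983to89.B5Symbol166Strip
import Literature.MathematicalPhysics.QuantumFieldTheory.Balaban1983to89.B6Cov2156Torus

/-!
# `Balaban1983to89.B5Kernel166Decay` — exponential decay of the kernel of the (1.66) operator `Δ_k` on the torus (`B6Cov2156Torus.KernelDecay` discharged)

T. Bałaban, *Propagators and renormalization transformations for lattice gauge theories. I*, Commun. Math.
Phys. **95**, 17–40 (1984) [`Balaban1984PropagatorsI`, cell paper B5], (1.66) p. 29 [PDF 13] (the quadratic
form `⟨B, Δ_kB⟩`, typed VERBATIM as `B5Bounds167Lattice.w166` / `formDk`, transcription certified in that module's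
header); the USE of the decay of the kernel of `Δ_k`: *… II*, Commun. Math. Phys. **96**, 223–250 (1984)
[`Balaban1984PropagatorsII`, B6] p. 250 [PDF 28], verbatim (render `…rt-II-p028-x2.png`, read as image): «C is a
short-ranged operator, so C*Δ_kC has the same exponential decay as Δ_k. Now we may apply the theory developed in
Sect. 5 of [3] on unit lattice operators.»; the METHOD: B5 p. 38 [PDF 22], the sentence before (1.126), «… the
analyticity method of proving an exponential decay (see the proof of Lemma 2.4 in [2])».  B5/B6 print NO numbered
display asserting the decay of the kernel of `Δ_k`; p. 250 presupposes it.  Everything below is `[folklore]` audit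
mathematics about the printed symbol (1.66); the `[cite: …]` tags are TEXT LOCATIONS of the quoted formulas only —
nothing is minted as a cited fact (ABSOLUTE RULE).

## What this module proves (sorry-free)

* `kernelDecay166_succ` / `kernelDecay166`: there are `c₀(d), δ₀(d) > 0` (depending on the dimension ONLY) such that
  for EVERY period vector `M` (all `M_i ≥ 1`) and EVERY level `n ≥ 1` the polarization matrix `Δ = B6Cov2156Torus.deltaPol M n`
  of the (1.66) form in the bond basis of the torus satisfies
  `|Δ(b, b′)| ≤ c₀ e^{−δ₀ ρ_M(b₋, b′₋)}` — i.e. `B6Cov2156Torus.KernelDecay M n c₀ δ₀`, the ONE residual hypothesis of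
  `B6Cov2156Torus.cov2156_torus_deltaPol` (B6 (2.152)–(2.157) end to end on the whole torus);
* `cov2156_torus_166`: that theorem with the hypothesis discharged — for `d ≥ 2`, `L ≥ 1`: `∃ c, δ > 0` such that for every
  torus with `L ∣ M_i` and every `n ≥ 1`, `|C^{(k)}(b, b′)| ≤ c e^{−δ ρ_M(b₋, b′₋)}` for the covariance
  `C(C*ΔC)⁻¹C*` of (2.156) built on `Δ = deltaPol M n`.

## Mechanism (the analyticity method, B5 p. 38, for the (1.66) symbol)

1. (§1, any `d`) BOOKKEEPING of `deltaPol`: for basis bonds `b = (x, α)`, `b′ = (y, β)` the unitary DFT of `e_b` is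
   `δ_{ν α} · dft(t, x̄)` (`hat_single`), so `φ_{μν t}(e_b) = dft(t, x̄)(ι_{να} ∂¹_μ − ι_{μα} ∂¹_ν)(p′_t)` (`phiC_single`),
   `conj dft(t, x̄) · dft(t, ȳ) = |T|⁻¹ e^{i t·(x̄−ȳ)}` (`conj_dft_mul_dft`), and
   `Σ_t ½w(p′_t) Re(conj φ(e_b) φ(e_b′)) = Re(ι ι K_{μμ} − ι ι K_{μν} − ι ι K_{νμ} + ι ι K_{νν})` (`inner_eq`) with the
   entry kernels `K_{ab}(z) = |T|⁻¹ Σ_t e^{i t·z} · ½ w166(p′_t) conj ∂¹_a(p′_t) ∂¹_b(p′_t)` (`ksum`); the `μ = ν` terms vanish.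
2. (§2, dimension `d+1`) THE GRID DICTIONARY: `Tor M ≃ Π_i Fin M_i` (`torFin`), `e^{i t·z̄} = mFourier z (k/M)`
   (`chi_toT_eq_mFourier`), and the momenta `p′_t = sOf M t ∈ (−π, π]` versus `2π rep(k/M) ∈ [−π, π)` agree except on
   the far face, where they are `π` versus `−π` (`two_pi_rep_grid`) — immaterial for a strip-regular (hence
   `2π`-periodic-on-the-faces) multiplier by `B4TorusKernel.face_match` (`Gsym_grid_eq`).  With
   `B5Symbol166Strip.Gsym_ofReal` (the continued symbol restricts to `½ w166 conj ∂¹_a ∂¹_b` on the punctured real zone)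
   and `Gsym_ofReal_zero`, `K_{ab}(x̄) = MultiPeriod.torusKernel (descendC Gsym …) M x` (`ksum_toT_eq_torusKernel`).
3. (§3) DECAY: `B5Symbol166Strip.stripRegular_Gsym` (strip width `κ = kappa166 (d+1)`, bound `MG (d+1)`, both d-only,
   uniform in `n ≥ 1` and in `M`) and the Poisson-periodisation engine `B4TorusKernel.MultiPeriod.torusKernel_descend_decay_torusMetric`
   give `‖K_{ab}(x)‖ ≤ MG · periodConst κ d · e^{−(κ/(d+1)) |x|_{T,∞}}`; `ρ_M ≤ |·|_{T,∞}` (`pdist_le_torusSupNorm`, in fact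
   equal) and the count `(d+1)² · 4` of terms give `KernelDecay` with `c₀ = 4(d+1)² MG(d+1) periodConst(κ, d)`, `δ₀ = κ/(d+1)`.

## Honest scope

* Constants are crude and depend on `d` only; no attempt at Bałaban's constants.  `U = 1`, `m² = 0` as in
  `B5Bounds167Lattice` (recorded there and in DIVERGENCE D-b05g9.2).
* This is an AUDIT CONSTRUCTION filling a step B6 p. 250 presupposes; it is not a transcription of a printed proof.
* Value = kernel certificate; NOT summit progress, NOT continuum, NOT Clay.
-/

open Finset

namespace Literature.MathematicalPhysics.QuantumFieldTheory.Balaban1983to89.B5Kernel166Decay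

open B4Strip (ofRealVec)
open B4ContourShift (BZ StripRegular)
open B4TorusKernel (descend descendC descendC_apply face_match rep_mem rep_coe rep_coe_half periodConst)
open B4TorusKernel.MultiPeriod (gridPt torusSum torusKernel circAbs torusSupNorm torusSupNorm_nonneg
  torusKernel_descend_decay_torusMetric)
open B5Prop11Plancherel (Tor chi dft sOf conj_chi chi_add_right abs_sOf_le sOf_ne_zero sOf_zero)
open B5Prop11Fiber (d1Sym)
open B5Bounds167Lattice (w166 comp hat curlHat ofRealCfg)
open B5Symbol166Strip (kappa166 kappa166_pos Gsym MG MG_pos stripRegular_Gsym Gsym_ofReal Gsym_ofReal_zero)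
open B6Lemma24Torus (pbox mem_pbox)
open B6BondEliminationTorus (res pdist circAbs_res tdist_le_of_forall)
open B6LowerBound2153Torus (toT toT_rep rep_toT rep_mem_pbox toT_add)
open B6Cov2156Torus (ofBox phiC wgt deltaPol KernelDecay one_le_M bondReductionT cov2156_torus_deltaPol)

noncomputable section

variable {d : ℕ}

/-! ## §1  Bookkeeping of `deltaPol` in the bond basis (any dimension) -/

section General

variable (M : Fin d → ℕ) [hM : ∀ μ, NeZero (M μ)]

/-- the torus `Π_μ ℤ/M_μ` as the dependent grid `Π_μ Fin M_μ` of `B4TorusKernel.MultiPeriod` (coordinates = `ZMod.val`).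
[folklore] -/
def torFin : Tor M ≃ ((i : Fin d) → Fin (M i)) where
  toFun t := fun i => ⟨(t i).val, ZMod.val_lt (t i)⟩
  invFun k := fun i => ((k i : ℕ) : ZMod (M i))
  left_inv t := by
    funext i
    exact ZMod.natCast_zmod_val (t i)
  right_inv k := by
    funext i
    apply Fin.ext
    show (((k i : ℕ) : ZMod (M i))).val = (k i : ℕ)
    rw [ZMod.val_natCast, Nat.mod_eq_of_lt (k i).isLt]

/-- `|T| = Π_μ M_μ` (as a complex number). [folklore] -/
theorem card_Tor_cast : (Fintype.card (Tor M) : ℂ) = ∏ i, ((M i : ℕ) : ℂ) := by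
  rw [Fintype.card_pi]
  push_cast
  exact Finset.prod_congr rfl fun i _ => by rw [ZMod.card]

omit hM in
/-- the quotient map is compatible with subtraction. [folklore] -/
theorem toT_sub (x y : Fin d → ℤ) : toT M x - toT M y = toT M (x - y) := by
  funext i
  simp [toT]

/-- the field `e_b`, `b = (x, α)`, read on `Tor M × Fin d`: the indicator of `(x̄, α)`. [folklore] -/
theorem ofBox_single (p : B4.Idx (pbox M) d) (x : Tor M) (ν : Fin d) :
    ofBox M (Pi.single p (1 : ℝ)) (x, ν) = if x = toT M (p.1 : Fin d → ℤ) ∧ ν = p.2 then 1 else 0 := by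
  classical
  have key : ((⟨B6LowerBound2153Torus.rep M x, rep_mem_pbox M x⟩, ν) : B4.Idx (pbox M) d) = p
      ↔ (x = toT M (p.1 : Fin d → ℤ) ∧ ν = p.2) := by
    constructor
    · rintro rfl
      exact ⟨(toT_rep M x).symm, rfl⟩
    · rintro ⟨hx, hν⟩
      subst hν
      refine Prod.ext (Subtype.ext ?_) rfl
      show B6LowerBound2153Torus.rep M x = (p.1 : Fin d → ℤ)
      rw [hx]
      exact rep_toT M p.1.2
  show (Pi.single p 1 : B4.Idx (pbox M) d → ℝ) (⟨B6LowerBound2153Torus.rep M x, rep_mem_pbox M x⟩, ν) = _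
  rw [Pi.single_apply]
  by_cases h : x = toT M (p.1 : Fin d → ℤ) ∧ ν = p.2
  · rw [if_pos h, if_pos (key.mpr h)]
  · rw [if_neg h, if_neg (fun e => h (key.mp e))]

/-- the 0/1 indicator `ι_{κ α}` of "`κ` is the direction `α` of the bond `b = (x, α)`", as a real number. [folklore] -/
def dirInd (κ : Fin d) (p : B4.Idx (pbox M) d) : ℝ := if κ = p.2 then 1 else 0

omit hM in
/-- `‖ι‖ ≤ 1`. [folklore] -/
theorem norm_dirInd_le (κ : Fin d) (p : B4.Idx (pbox M) d) : ‖((dirInd M κ p : ℝ) : ℂ)‖ ≤ 1 := by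
  unfold dirInd
  split_ifs <;> simp

/-- the unitary DFT of the component `ν` of `e_b`: `δ_{ν α} dft(t, x̄)`. [folklore] -/
theorem hat_single (p : B4.Idx (pbox M) d) (ν : Fin d) (t : Tor M) :
    hat M (ofRealCfg M (ofBox M (Pi.single p (1 : ℝ)))) ν t
      = ((dirInd M ν p : ℝ) : ℂ) * dft M t (toT M (p.1 : Fin d → ℤ)) := by
  classical
  show Matrix.mulVec (dft M) (comp M (ofRealCfg M (ofBox M (Pi.single p (1 : ℝ)))) ν) t = _
  simp only [Matrix.mulVec, dotProduct]
  have hv : ∀ x, comp M (ofRealCfg M (ofBox M (Pi.single p (1 : ℝ)))) ν x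
      = if x = toT M (p.1 : Fin d → ℤ) ∧ ν = p.2 then (1 : ℂ) else 0 := by
    intro x
    show ((ofBox M (Pi.single p (1 : ℝ)) (x, ν) : ℝ) : ℂ) = _
    rw [ofBox_single]
    split_ifs <;> simp
  simp_rw [hv]
  unfold dirInd
  by_cases hν : ν = p.2
  · simp only [hν, and_true, mul_ite, mul_one, mul_zero, Finset.sum_ite_eq', Finset.mem_univ, if_true]
    simp
  · simp [hν]

/-- the (1.66) coefficient of `e_b`: `φ_{μν t}(e_b) = dft(t, x̄) · (ι_{να} ∂¹_μ(p′_t) − ι_{μα} ∂¹_ν(p′_t))`.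
[cite: Balaban1984PropagatorsI, (1.66) p.29 (location of the formula; bookkeeping ours)] [folklore] -/
theorem phiC_single (p : B4.Idx (pbox M) d) (μ ν : Fin d) (t : Tor M) :
    phiC M (Pi.single p (1 : ℝ)) μ ν t
      = dft M t (toT M (p.1 : Fin d → ℤ)) *
          (((dirInd M ν p : ℝ) : ℂ) * d1Sym (sOf M t) μ - ((dirInd M μ p : ℝ) : ℂ) * d1Sym (sOf M t) ν) := by
  show d1Sym (sOf M t) μ * hat M (ofRealCfg M (ofBox M (Pi.single p (1 : ℝ)))) ν t
      - d1Sym (sOf M t) ν * hat M (ofRealCfg M (ofBox M (Pi.single p (1 : ℝ)))) μ t = _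
  rw [hat_single, hat_single]
  ring

/-- `e^{i(−t)·a} = e^{i t·(−a)}`. [folklore] -/
theorem chi_neg_comm (t a : Tor M) : chi M (-t) a = chi M t (-a) := by
  unfold chi
  refine Finset.prod_congr rfl fun μ _ => ?_
  rw [Pi.neg_apply, Pi.neg_apply, neg_mul, mul_neg]

/-- `conj dft(t, a) · dft(t, b) = |T|⁻¹ e^{i t·(a − b)}`. [folklore] -/
theorem conj_dft_mul_dft (t a b : Tor M) :
    (starRingEnd ℂ) (dft M t a) * dft M t b = ((Fintype.card (Tor M) : ℂ))⁻¹ * chi M t (a - b) := by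
  have hc : (0 : ℝ) < Fintype.card (Tor M) := by exact_mod_cast Fintype.card_pos
  unfold dft
  rw [map_mul, Complex.conj_ofReal, Complex.conj_conj, conj_chi, chi_neg_comm, sub_eq_add_neg, chi_add_right]
  have : (((Real.sqrt (Fintype.card (Tor M)))⁻¹ : ℝ) : ℂ) * (((Real.sqrt (Fintype.card (Tor M)))⁻¹ : ℝ) : ℂ)
      = ((Fintype.card (Tor M) : ℂ))⁻¹ := by
    rw [← Complex.ofReal_mul, ← mul_inv, Real.mul_self_sqrt hc.le]
    push_cast
    rfl
  rw [← this]
  ring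

/-- THE ENTRY KERNEL SUM `K_{ab}(z) = |T|⁻¹ Σ_t e^{i t·z} · ½ w166_{μν}(p′_t) · conj ∂¹_a(p′_t) · ∂¹_b(p′_t)` —
the torus kernel of the `(a, b)` entry of the matrix symbol of the `(μ, ν)` term of (1.66).
[cite: Balaban1984PropagatorsI, (1.66) p.29 (location; packaging ours)] [folklore] -/
def ksum (n : ℕ) (μ ν a b : Fin d) (z : Tor M) : ℂ :=
  ((Fintype.card (Tor M) : ℂ))⁻¹ * ∑ t : Tor M, chi M t z *
    (1 / 2 * (w166 n μ ν (sOf M t) : ℂ) * ((starRingEnd ℂ) (d1Sym (sOf M t) a) * d1Sym (sOf M t) b))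

/-- per momentum: `½w · conj φ(e_b) φ(e_b′) = |T|⁻¹ e^{it·(x̄−ȳ)} ½w · (ιconj∂¹ − ιconj∂¹)(ι∂¹ − ι∂¹)`. [folklore] -/
theorem wgt_mul_term (n : ℕ) (p q : B4.Idx (pbox M) d) (μ ν : Fin d) (t : Tor M) :
    ((wgt M n ((μ, ν), t) : ℝ) : ℂ) *
        ((starRingEnd ℂ) (phiC M (Pi.single p 1) μ ν t) * phiC M (Pi.single q 1) μ ν t)
      = ((Fintype.card (Tor M) : ℂ))⁻¹ *
          (chi M t (toT M (p.1 : Fin d → ℤ) - toT M (q.1 : Fin d → ℤ)) *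
            (1 / 2 * (w166 n μ ν (sOf M t) : ℂ) *
              ((((dirInd M ν p : ℝ) : ℂ) * (starRingEnd ℂ) (d1Sym (sOf M t) μ)
                  - ((dirInd M μ p : ℝ) : ℂ) * (starRingEnd ℂ) (d1Sym (sOf M t) ν)) *
                (((dirInd M ν q : ℝ) : ℂ) * d1Sym (sOf M t) μ - ((dirInd M μ q : ℝ) : ℂ) * d1Sym (sOf M t) ν)))) := by
  have hw : ((wgt M n ((μ, ν), t) : ℝ) : ℂ) = 1 / 2 * (w166 n μ ν (sOf M t) : ℂ) := by
    show (((1 / 2 * w166 n μ ν (sOf M t) : ℝ)) : ℂ) = _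
    push_cast
    ring
  have hd := conj_dft_mul_dft M t (toT M (p.1 : Fin d → ℤ)) (toT M (q.1 : Fin d → ℤ))
  rw [hw, phiC_single, phiC_single, map_mul, map_sub, map_mul, map_mul, Complex.conj_ofReal, Complex.conj_ofReal]
  linear_combination (1 / 2 * (w166 n μ ν (sOf M t) : ℂ) *
    ((((dirInd M ν p : ℝ) : ℂ) * (starRingEnd ℂ) (d1Sym (sOf M t) μ)
        - ((dirInd M μ p : ℝ) : ℂ) * (starRingEnd ℂ) (d1Sym (sOf M t) ν)) *
      (((dirInd M ν q : ℝ) : ℂ) * d1Sym (sOf M t) μ - ((dirInd M μ q : ℝ) : ℂ) * d1Sym (sOf M t) ν))) * hd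

/-- **THE (μ,ν) TERM OF `deltaPol` IN THE BOND BASIS**:
`Σ_t ½w Re(conj φ(e_b) φ(e_b′)) = Re(ι_{να}ι_{νβ} K_{μμ} − ι_{να}ι_{μβ} K_{μν} − ι_{μα}ι_{νβ} K_{νμ} + ι_{μα}ι_{μβ} K_{νν})(x̄ − ȳ)`.
[folklore] -/
theorem inner_eq (n : ℕ) (p q : B4.Idx (pbox M) d) (μ ν : Fin d) :
    ∑ t : Tor M, wgt M n ((μ, ν), t) *
        ((starRingEnd ℂ) (phiC M (Pi.single p 1) μ ν t) * phiC M (Pi.single q 1) μ ν t).re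
      = (((dirInd M ν p : ℝ) : ℂ) * ((dirInd M ν q : ℝ) : ℂ) *
            ksum M n μ ν μ μ (toT M (p.1 : Fin d → ℤ) - toT M (q.1 : Fin d → ℤ))
          - ((dirInd M ν p : ℝ) : ℂ) * ((dirInd M μ q : ℝ) : ℂ) *
            ksum M n μ ν μ ν (toT M (p.1 : Fin d → ℤ) - toT M (q.1 : Fin d → ℤ))
          - ((dirInd M μ p : ℝ) : ℂ) * ((dirInd M ν q : ℝ) : ℂ) *
            ksum M n μ ν ν μ (toT M (p.1 : Fin d → ℤ) - toT M (q.1 : Fin d → ℤ))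
          + ((dirInd M μ p : ℝ) : ℂ) * ((dirInd M μ q : ℝ) : ℂ) *
            ksum M n μ ν ν ν (toT M (p.1 : Fin d → ℤ) - toT M (q.1 : Fin d → ℤ))).re := by
  have h1 : ∀ t : Tor M, wgt M n ((μ, ν), t) *
        ((starRingEnd ℂ) (phiC M (Pi.single p 1) μ ν t) * phiC M (Pi.single q 1) μ ν t).re
      = (((wgt M n ((μ, ν), t) : ℝ) : ℂ) *
          ((starRingEnd ℂ) (phiC M (Pi.single p 1) μ ν t) * phiC M (Pi.single q 1) μ ν t)).re := by
    intro t
    rw [Complex.re_ofReal_mul]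
  simp_rw [h1]
  rw [← Complex.re_sum]
  congr 1
  simp_rw [wgt_mul_term]
  unfold ksum
  simp only [Finset.mul_sum]
  rw [← Finset.sum_sub_distrib, ← Finset.sum_sub_distrib, ← Finset.sum_add_distrib]
  refine Finset.sum_congr rfl fun t _ => ?_
  ring

/-- the `μ = ν` term vanishes. [folklore] -/
theorem inner_eq_zero_of_eq (n : ℕ) (p q : B4.Idx (pbox M) d) (μ : Fin d) :
    ∑ t : Tor M, wgt M n ((μ, μ), t) *
        ((starRingEnd ℂ) (phiC M (Pi.single p 1) μ μ t) * phiC M (Pi.single q 1) μ μ t).re = 0 := by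
  rw [inner_eq]
  have : (((dirInd M μ p : ℝ) : ℂ) * ((dirInd M μ q : ℝ) : ℂ) *
            ksum M n μ μ μ μ (toT M (p.1 : Fin d → ℤ) - toT M (q.1 : Fin d → ℤ))
          - ((dirInd M μ p : ℝ) : ℂ) * ((dirInd M μ q : ℝ) : ℂ) *
            ksum M n μ μ μ μ (toT M (p.1 : Fin d → ℤ) - toT M (q.1 : Fin d → ℤ))
          - ((dirInd M μ p : ℝ) : ℂ) * ((dirInd M μ q : ℝ) : ℂ) *
            ksum M n μ μ μ μ (toT M (p.1 : Fin d → ℤ) - toT M (q.1 : Fin d → ℤ))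
          + ((dirInd M μ p : ℝ) : ℂ) * ((dirInd M μ q : ℝ) : ℂ) *
            ksum M n μ μ μ μ (toT M (p.1 : Fin d → ℤ) - toT M (q.1 : Fin d → ℤ))) = 0 := by ring
  rw [this]
  simp

/-- the `(μ, ν)` term is dominated by the four entry kernels (the indicators are `≤ 1`). [folklore] -/
theorem abs_inner_le (n : ℕ) (p q : B4.Idx (pbox M) d) (μ ν : Fin d) :
    |∑ t : Tor M, wgt M n ((μ, ν), t) *
        ((starRingEnd ℂ) (phiC M (Pi.single p 1) μ ν t) * phiC M (Pi.single q 1) μ ν t).re|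
      ≤ ‖ksum M n μ ν μ μ (toT M (p.1 : Fin d → ℤ) - toT M (q.1 : Fin d → ℤ))‖
        + ‖ksum M n μ ν μ ν (toT M (p.1 : Fin d → ℤ) - toT M (q.1 : Fin d → ℤ))‖
        + ‖ksum M n μ ν ν μ (toT M (p.1 : Fin d → ℤ) - toT M (q.1 : Fin d → ℤ))‖
        + ‖ksum M n μ ν ν ν (toT M (p.1 : Fin d → ℤ) - toT M (q.1 : Fin d → ℤ))‖ := by
  rw [inner_eq]
  refine (Complex.abs_re_le_norm _).trans ?_
  set K1 := ksum M n μ ν μ μ (toT M (p.1 : Fin d → ℤ) - toT M (q.1 : Fin d → ℤ)) with hK1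
  set K2 := ksum M n μ ν μ ν (toT M (p.1 : Fin d → ℤ) - toT M (q.1 : Fin d → ℤ)) with hK2
  set K3 := ksum M n μ ν ν μ (toT M (p.1 : Fin d → ℤ) - toT M (q.1 : Fin d → ℤ)) with hK3
  set K4 := ksum M n μ ν ν ν (toT M (p.1 : Fin d → ℤ) - toT M (q.1 : Fin d → ℤ)) with hK4
  set a := ((dirInd M ν p : ℝ) : ℂ) with ha_def
  set b := ((dirInd M ν q : ℝ) : ℂ) with hb_def
  set c := ((dirInd M μ p : ℝ) : ℂ) with hc_def
  set e := ((dirInd M μ q : ℝ) : ℂ) with he_def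
  have ha : ‖a‖ ≤ 1 := norm_dirInd_le M ν p
  have hb : ‖b‖ ≤ 1 := norm_dirInd_le M ν q
  have hc : ‖c‖ ≤ 1 := norm_dirInd_le M μ p
  have he : ‖e‖ ≤ 1 := norm_dirInd_le M μ q
  have hι : ∀ (s s' K : ℂ), ‖s‖ ≤ 1 → ‖s'‖ ≤ 1 → ‖s * s' * K‖ ≤ ‖K‖ := by
    intro s s' K hs hs'
    rw [norm_mul, norm_mul]
    have hK := norm_nonneg K
    have hs0 := norm_nonneg s
    have hs0' := norm_nonneg s'
    calc ‖s‖ * ‖s'‖ * ‖K‖ ≤ 1 * 1 * ‖K‖ := by gcongr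
      _ = ‖K‖ := by ring
  calc ‖a * b * K1 - a * e * K2 - c * b * K3 + c * e * K4‖
      ≤ ‖a * b * K1 - a * e * K2 - c * b * K3‖ + ‖c * e * K4‖ := norm_add_le _ _
    _ ≤ ‖a * b * K1 - a * e * K2‖ + ‖c * b * K3‖ + ‖c * e * K4‖ := by
        gcongr
        exact norm_sub_le _ _
    _ ≤ ‖a * b * K1‖ + ‖a * e * K2‖ + ‖c * b * K3‖ + ‖c * e * K4‖ := by
        gcongr
        exact norm_sub_le _ _
    _ ≤ ‖K1‖ + ‖K2‖ + ‖K3‖ + ‖K4‖ := by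
        gcongr
        · exact hι _ _ _ ha hb
        · exact hι _ _ _ ha he
        · exact hι _ _ _ hc hb
        · exact hι _ _ _ hc he

/-- `deltaPol` as the double sum over `(μ, ν)` of the `(μ, ν)` terms. [folklore] -/
theorem deltaPol_eq_sum (n : ℕ) (p q : B4.Idx (pbox M) d) :
    deltaPol M n p q = ∑ μ : Fin d, ∑ ν : Fin d, ∑ t : Tor M, wgt M n ((μ, ν), t) *
        ((starRingEnd ℂ) (phiC M (Pi.single p 1) μ ν t) * phiC M (Pi.single q 1) μ ν t).re := by
  unfold deltaPol
  rw [Fintype.sum_prod_type, Fintype.sum_prod_type]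

end General

/-! ## §2  The grid dictionary `Tor M ↔ Π_μ Fin M_μ` and the torus kernel of the continued symbol (dimension `d + 1`) -/

section Grid

variable (M : Fin (d + 1) → ℕ) [hM : ∀ μ, NeZero (M μ)]

/-- the torus character at a lattice point is the `mFourier` character at the grid point:
`Π_μ ψ_{M_μ}(t_μ x_μ) = Π_μ e^{2πi x_μ t_μ / M_μ}`. [folklore] -/
theorem chi_toT_eq_mFourier (t : Tor M) (x : Fin (d + 1) → ℤ) :
    chi M t (toT M x) = UnitAddTorus.mFourier x (gridPt M (torFin M t)) := by
  show (∏ μ, (ZMod.stdAddChar (N := M μ)) (t μ * (toT M x) μ))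
      = ∏ i, fourier (x i) (((((torFin M t i : ℕ) : ℝ) / M i : ℝ) : UnitAddCircle))
  refine Finset.prod_congr rfl fun i _ => ?_
  have h1 : t i * (toT M x) i = ((((t i).val : ℤ) * x i : ℤ) : ZMod (M i)) := by
    rw [Int.cast_mul, Int.cast_natCast, ZMod.natCast_zmod_val]
    rfl
  rw [h1, ZMod.stdAddChar_coe, fourier_coe_apply]
  congr 1
  have hv : ((torFin M t i : ℕ) : ℝ) = (((t i).val : ℕ) : ℝ) := rfl
  rw [hv]
  push_cast
  ring

/-- the two momentum conventions on the grid: `2π rep(t_μ/M_μ) ∈ [−π, π)` (engine) versus `p′_μ = sOf ∈ (−π, π]`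
((1.29) via `valMinAbs`) — equal, except on the far face `2 t_μ = M_μ` where they are `−π` and `π`. [folklore] -/
theorem two_pi_rep_grid (t : Tor M) (i : Fin (d + 1)) :
    (2 * Real.pi * B4TorusKernel.rep ((((torFin M t i : ℕ) : ℝ) / M i : ℝ) : UnitAddCircle) = sOf M t i) ∨
    (2 * Real.pi * B4TorusKernel.rep ((((torFin M t i : ℕ) : ℝ) / M i : ℝ) : UnitAddCircle) = -Real.pi
      ∧ sOf M t i = Real.pi) := by
  have hv : ((torFin M t i : ℕ) : ℝ) = (((t i).val : ℕ) : ℝ) := rfl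
  rw [hv]
  have hNpos : 0 < M i := Nat.pos_of_ne_zero (NeZero.ne _)
  have hvN : (t i).val < M i := ZMod.val_lt _
  have hNr : (0 : ℝ) < (M i : ℝ) := by exact_mod_cast hNpos
  have hs : sOf M t i = 2 * Real.pi * (((t i).valMinAbs : ℤ) : ℝ) / (M i : ℝ) := rfl
  have hvma : ((t i).valMinAbs : ℤ) = if (t i).val ≤ M i / 2 then ((t i).val : ℤ) else ((t i).val : ℤ) - (M i : ℕ) :=
    ZMod.valMinAbs_def_pos _
  rcases lt_trichotomy (2 * (t i).val) (M i) with h | h | h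
  · left
    have hmem : (((t i).val : ℕ) : ℝ) / (M i : ℝ) ∈ Set.Ico (-(1 / 2 : ℝ)) (1 / 2) := by
      refine ⟨?_, ?_⟩
      · have : (0 : ℝ) ≤ (((t i).val : ℕ) : ℝ) / (M i : ℝ) := by positivity
        linarith
      · rw [div_lt_iff₀ hNr]
        have : (2 * (t i).val : ℝ) < (M i : ℝ) := by exact_mod_cast h
        linarith
    rw [rep_coe hmem, hs, hvma, if_pos (by omega)]
    push_cast
    ring
  · right
    have hhalf : (((t i).val : ℕ) : ℝ) / (M i : ℝ) = 1 / 2 := by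
      rw [div_eq_iff hNr.ne']
      have : (2 * (t i).val : ℝ) = (M i : ℝ) := by exact_mod_cast h
      linarith
    rw [hhalf, rep_coe_half, hs, hvma, if_pos (by omega)]
    refine ⟨by ring, ?_⟩
    rw [div_eq_iff hNr.ne']
    have : (2 * (t i).val : ℝ) = (M i : ℝ) := by exact_mod_cast h
    push_cast
    rw [← this]
    ring
  · left
    have e : (((((t i).val : ℕ) : ℝ) / (M i : ℝ) : ℝ) : UnitAddCircle)
        = (((((t i).val : ℕ) : ℝ) / (M i : ℝ) - 1 : ℝ) : UnitAddCircle) := by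
      rw [← AddCircle.coe_add_period 1 ((((t i).val : ℕ) : ℝ) / (M i : ℝ) - 1)]
      congr 1
      ring
    have hmem : (((t i).val : ℕ) : ℝ) / (M i : ℝ) - 1 ∈ Set.Ico (-(1 / 2 : ℝ)) (1 / 2) := by
      refine ⟨?_, ?_⟩
      · have : (M i : ℝ) ≤ (2 * (t i).val : ℝ) := by exact_mod_cast h.le
        rw [le_sub_iff_add_le, le_div_iff₀ hNr]
        linarith
      · have : (((t i).val : ℕ) : ℝ) < (M i : ℝ) := by exact_mod_cast hvN
        rw [sub_lt_iff_lt_add, div_lt_iff₀ hNr]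
        linarith
    rw [e, rep_coe hmem, hs, hvma, if_neg (by omega)]
    push_cast
    field_simp

/-- the two momentum conventions give the same value of the continued symbol (the face flip is absorbed by the
`2π`-periodicity of a strip-regular multiplier across the faces, `B4TorusKernel.face_match`). [folklore] -/
theorem Gsym_grid_eq (n : ℕ) [NeZero n] {κ : ℝ} (hκ0 : 0 ≤ κ) (hκ : κ ≤ kappa166 (d + 1)) {μ ν : Fin (d + 1)}
    (hμν : μ ≠ ν) (a b : Fin (d + 1)) (t : Tor M) :
    Gsym n μ ν a b
        (ofRealVec (fun i => 2 * Real.pi * B4TorusKernel.rep ((((torFin M t i : ℕ) : ℝ) / M i : ℝ) : UnitAddCircle)))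
      = Gsym n μ ν a b (ofRealVec (sOf M t)) := by
  classical
  set u : Fin (d + 1) → ℝ :=
    fun i => 2 * Real.pi * B4TorusKernel.rep ((((torFin M t i : ℕ) : ℝ) / M i : ℝ) : UnitAddCircle) with hu_def
  have hdich : ∀ i, u i = sOf M t i ∨ (u i = -Real.pi ∧ sOf M t i = Real.pi) := fun i => two_pi_rep_grid M t i
  have hu : u ∈ BZ (d + 1) := by
    refine ⟨fun i => ?_, fun i => ?_⟩
    · have h := (rep_mem (((((torFin M t i : ℕ) : ℝ) / M i : ℝ) : UnitAddCircle))).1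
      show -Real.pi ≤ 2 * Real.pi * _
      nlinarith [Real.pi_pos]
    · have h := (rep_mem (((((torFin M t i : ℕ) : ℝ) / M i : ℝ) : UnitAddCircle))).2
      show 2 * Real.pi * _ ≤ Real.pi
      nlinarith [Real.pi_pos]
  have hv : sOf M t ∈ BZ (d + 1) :=
    ⟨fun i => (abs_le.mp (abs_sOf_le M t i)).1, fun i => (abs_le.mp (abs_sOf_le M t i)).2⟩
  refine face_match (stripRegular_Gsym n hκ0 hκ hμν a b) hκ0 (Finset.univ.filter fun i => u i ≠ sOf M t i)
    u (sOf M t) hu hv (fun i hi => ?_) (fun i hi => ?_)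
  · by_contra h
    exact hi (Finset.mem_filter.mpr ⟨Finset.mem_univ _, h⟩)
  · have h := (Finset.mem_filter.mp hi).2
    rcases hdich i with h' | h'
    · exact absurd h' h
    · exact h'

/-- **THE ENTRY KERNEL IS THE TORUS KERNEL OF THE CONTINUED SYMBOL**: for `μ ≠ ν`, `n ≥ 1`,
`K_{ab}(x̄) = MultiPeriod.torusKernel (descendC (Gsym n μ ν a b) …) M x`. [folklore] -/
theorem ksum_toT_eq_torusKernel (n : ℕ) [NeZero n] {κ : ℝ} (hκ0 : 0 < κ) (hκ : κ ≤ kappa166 (d + 1))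
    {μ ν : Fin (d + 1)} (hμν : μ ≠ ν) (a b : Fin (d + 1)) (x : Fin (d + 1) → ℤ) :
    ksum M n μ ν a b (toT M x)
      = torusKernel (descendC (fun p => Gsym n μ ν a b p) (stripRegular_Gsym n hκ0.le hκ hμν a b) hκ0.le) M x := by
  unfold ksum torusKernel torusSum
  rw [card_Tor_cast]
  congr 1
  refine Fintype.sum_equiv (torFin M) _ _ fun t => ?_
  rw [descendC_apply, B4TorusKernel.MultiPeriod.descend_gridPt, chi_toT_eq_mFourier, mul_comm]
  congr 1
  rw [Gsym_grid_eq M n hκ0.le hκ hμν a b t]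
  by_cases ht : t = 0
  · subst ht
    rw [sOf_zero]
    rw [show ((0 : Fin (d + 1) → ℝ)) = (fun _ => (0 : ℝ)) from rfl, Gsym_ofReal_zero]
    simp [d1Sym]
  · obtain ⟨ν₀, hν₀⟩ := Function.ne_iff.mp (sOf_ne_zero M ht)
    rw [Gsym_ofReal n hμν a b (sOf M t) (fun κ' => abs_sOf_le M t κ') ν₀ hν₀]

/-- `0 < periodConst κ d` for `κ > 0`. [folklore] -/
theorem periodConst_pos {κ : ℝ} (hκ : 0 < κ) (d : ℕ) : 0 < periodConst κ d := by
  unfold periodConst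
  apply pow_pos
  apply div_pos (by positivity)
  have h1 : -(κ / ((d : ℝ) + 1)) < 0 := by
    have : 0 < κ / ((d : ℝ) + 1) := by positivity
    linarith
  have h2 := Real.exp_lt_one_iff.mpr h1
  linarith

/-- **DECAY OF THE ENTRY KERNELS**, uniformly in the period vector and in `n ≥ 1`:
`‖K_{ab}(x̄)‖ ≤ MG(d+1) · periodConst(κ, d) · e^{−(κ/(d+1)) |x|_{T,∞}}`, `κ = kappa166 (d+1)`.
[cite: Balaban1984PropagatorsI, p.38 (1.126) (location of the method); Balaban1984PropagatorsII, p.250 (location of the use)] [folklore] -/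
theorem norm_ksum_le (n : ℕ) [NeZero n] {μ ν : Fin (d + 1)} (hμν : μ ≠ ν) (a b : Fin (d + 1))
    (x : Fin (d + 1) → ℤ) :
    ‖ksum M n μ ν a b (toT M x)‖
      ≤ MG (d + 1) * periodConst (kappa166 (d + 1)) d *
          Real.exp (-(kappa166 (d + 1) / (d + 1) * torusSupNorm M x)) := by
  rw [ksum_toT_eq_torusKernel M n (kappa166_pos (d + 1)) le_rfl hμν a b x]
  exact torusKernel_descend_decay_torusMetric _ (kappa166_pos _) (one_le_M M) x

/-- the periodic bond distance `ρ_M` of B6 is dominated by (in fact equal to) the torus sup-distance of the engine. [folklore] -/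
theorem pdist_le_torusSupNorm (x y : Fin (d + 1) → ℤ) :
    pdist M (one_le_M M) x y ≤ torusSupNorm M (x - y) := by
  unfold pdist
  refine tdist_le_of_forall (one_le_M M) _ _ (torusSupNorm_nonneg (one_le_M M) _) fun i => ?_
  rw [circAbs_res]
  exact Finset.le_sup' (fun j => ((circAbs (M j) ((x - y) j) : ℤ) : ℝ)) (Finset.mem_univ i)

end Grid

/-! ## §3  `KernelDecay` with constants depending on the dimension only -/

/-- **EXPONENTIAL DECAY OF THE KERNEL OF `Δ_k` ON THE TORUS (dimension `d + 1`)**: there are `c₀, δ₀ > 0` depending on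
`d` only with `B6Cov2156Torus.KernelDecay M n c₀ δ₀` for every period vector `M` and every `n ≥ 1`.
[cite: Balaban1984PropagatorsII, p.250 «C*Δ_kC has the same exponential decay as Δ_k» (location of the use; the
proof is ours)] [folklore] -/
theorem kernelDecay166_succ : ∃ c₀ δ₀ : ℝ, 0 < c₀ ∧ 0 < δ₀ ∧
    ∀ (M : Fin (d + 1) → ℕ) [∀ μ, NeZero (M μ)] (n : ℕ), 1 ≤ n → KernelDecay M n c₀ δ₀ := by
  have hκ : 0 < kappa166 (d + 1) := kappa166_pos _
  have hB : 0 < MG (d + 1) * periodConst (kappa166 (d + 1)) d := mul_pos (MG_pos _) (periodConst_pos hκ d)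
  refine ⟨((d : ℝ) + 1) * ((d : ℝ) + 1) * (4 * (MG (d + 1) * periodConst (kappa166 (d + 1)) d)),
    kappa166 (d + 1) / (d + 1), mul_pos (by positivity) (mul_pos (by norm_num) hB),
    div_pos hκ (by positivity), ?_⟩
  intro M _ n hn p q
  haveI : NeZero n := ⟨by omega⟩
  have hK : ∀ {μ ν : Fin (d + 1)}, μ ≠ ν → ∀ a b : Fin (d + 1),
      ‖ksum M n μ ν a b (toT M (p.1 : Fin (d + 1) → ℤ) - toT M (q.1 : Fin (d + 1) → ℤ))‖
        ≤ MG (d + 1) * periodConst (kappa166 (d + 1)) d *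
            Real.exp (-(kappa166 (d + 1) / (d + 1) *
              torusSupNorm M ((p.1 : Fin (d + 1) → ℤ) - (q.1 : Fin (d + 1) → ℤ)))) := by
    intro μ ν hμν a b
    rw [toT_sub]
    exact norm_ksum_le M n hμν a b _
  have hinner : ∀ μ ν : Fin (d + 1),
      |∑ t : Tor M, wgt M n ((μ, ν), t) *
          ((starRingEnd ℂ) (phiC M (Pi.single p 1) μ ν t) * phiC M (Pi.single q 1) μ ν t).re|
        ≤ 4 * (MG (d + 1) * periodConst (kappa166 (d + 1)) d *
            Real.exp (-(kappa166 (d + 1) / (d + 1) *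
              torusSupNorm M ((p.1 : Fin (d + 1) → ℤ) - (q.1 : Fin (d + 1) → ℤ))))) := by
    intro μ ν
    by_cases hμν : μ = ν
    · subst hμν
      rw [inner_eq_zero_of_eq, abs_zero]
      exact mul_nonneg (by norm_num) (mul_nonneg hB.le (Real.exp_nonneg _))
    · refine (abs_inner_le M n p q μ ν).trans ?_
      have h1 := hK hμν μ μ
      have h2 := hK hμν μ ν
      have h3 := hK hμν ν μ
      have h4 := hK hμν ν ν
      linarith
  rw [deltaPol_eq_sum]
  refine (Finset.abs_sum_le_sum_abs _ _).trans ?_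
  refine (Finset.sum_le_sum fun μ _ => Finset.abs_sum_le_sum_abs _ _).trans ?_
  refine (Finset.sum_le_sum fun μ _ => Finset.sum_le_sum fun ν _ => hinner μ ν).trans ?_
  rw [Finset.sum_const, Finset.sum_const, Finset.card_univ, Fintype.card_fin, nsmul_eq_mul, nsmul_eq_mul]
  push_cast
  have hexp : Real.exp (-(kappa166 (d + 1) / (d + 1) *
        torusSupNorm M ((p.1 : Fin (d + 1) → ℤ) - (q.1 : Fin (d + 1) → ℤ))))
      ≤ Real.exp (-(kappa166 (d + 1) / (d + 1) *
        pdist M (one_le_M M) (p.1 : Fin (d + 1) → ℤ) (q.1 : Fin (d + 1) → ℤ))) := by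
    apply Real.exp_le_exp.mpr
    have hp := pdist_le_torusSupNorm M (p.1 : Fin (d + 1) → ℤ) (q.1 : Fin (d + 1) → ℤ)
    have hk : 0 < kappa166 (d + 1) / ((d : ℝ) + 1) := div_pos hκ (by positivity)
    exact neg_le_neg (mul_le_mul_of_nonneg_left hp hk.le)
  have h4 : 4 * (MG (d + 1) * periodConst (kappa166 (d + 1)) d *
        Real.exp (-(kappa166 (d + 1) / (d + 1) *
          torusSupNorm M ((p.1 : Fin (d + 1) → ℤ) - (q.1 : Fin (d + 1) → ℤ)))))
      ≤ 4 * (MG (d + 1) * periodConst (kappa166 (d + 1)) d *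
        Real.exp (-(kappa166 (d + 1) / (d + 1) *
          pdist M (one_le_M M) (p.1 : Fin (d + 1) → ℤ) (q.1 : Fin (d + 1) → ℤ)))) := by
    have := mul_le_mul_of_nonneg_left hexp hB.le
    linarith
  have hd1 : (0 : ℝ) ≤ (d : ℝ) + 1 := by positivity
  calc _ ≤ ((d : ℝ) + 1) * (((d : ℝ) + 1) * (4 * (MG (d + 1) * periodConst (kappa166 (d + 1)) d *
        Real.exp (-(kappa166 (d + 1) / (d + 1) *
          pdist M (one_le_M M) (p.1 : Fin (d + 1) → ℤ) (q.1 : Fin (d + 1) → ℤ)))))) :=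
        mul_le_mul_of_nonneg_left (mul_le_mul_of_nonneg_left h4 hd1) hd1
    _ = _ := by ring

/-- **THE RESIDUAL HYPOTHESIS OF `B6Cov2156Torus.cov2156_torus_deltaPol` DISCHARGED** (any dimension `d ≥ 1`; the
consumer needs `d ≥ 2`): `∃ c₀ δ₀ > 0` (d only) with `KernelDecay M n c₀ δ₀` for all `M`, all `n ≥ 1`. [folklore] -/
theorem kernelDecay166 (hd : 1 ≤ d) : ∃ c₀ δ₀ : ℝ, 0 < c₀ ∧ 0 < δ₀ ∧
    ∀ (M : Fin d → ℕ) [∀ μ, NeZero (M μ)] (n : ℕ), 1 ≤ n → KernelDecay M n c₀ δ₀ := by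
  obtain ⟨e, rfl⟩ : ∃ e, d = e + 1 := ⟨d - 1, by omega⟩
  exact kernelDecay166_succ

/-- **B6 (2.152)–(2.157) END TO END ON THE WHOLE TORUS FOR THE (1.66) FORM, WITH NO RESIDUAL HYPOTHESIS**:
`d ≥ 2`, `L ≥ 1` ⟹ `∃ c, δ > 0` such that for every torus (`L ∣ M_i`) and every level `n ≥ 1` the covariance
`C^{(k)} = C(C*ΔC)⁻¹C*` of (2.156) built on `Δ = deltaPol M n` satisfies `|C^{(k)}(b, b′)| ≤ c e^{−δ ρ_M(b₋, b′₋)}`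
(`B6Cov2156Torus.cov2156_torus_deltaPol` ∘ `kernelDecay166`).
[cite: Balaban1984PropagatorsII, (2.152)–(2.157) pp.249–250; Balaban1984PropagatorsI, (1.66) p.29 (locations)] [folklore] -/
theorem cov2156_torus_166 (hd : 2 ≤ d) {L : ℕ} (hL : 1 ≤ L) :
    ∃ c δ : ℝ, 0 < c ∧ 0 < δ ∧
      ∀ (M : Fin d → ℕ) [∀ μ, NeZero (M μ)], (∀ i, L ∣ M i) → ∀ n : ℕ, 1 ≤ n →
        ∀ p q : B4.Idx (pbox M) d, |(bondReductionT L M (deltaPol M n)).cov p q| ≤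
          c * Real.exp (-(δ * pdist M (one_le_M M) (p.1 : Fin d → ℤ) (q.1 : Fin d → ℤ))) := by
  obtain ⟨c₀, δ₀, hc₀, hδ₀, hK⟩ := kernelDecay166 (d := d) (by omega)
  obtain ⟨c, δ, hc, hδ, H⟩ := cov2156_torus_deltaPol d (L := L) hd hL hc₀ hδ₀
  exact ⟨c, δ, hc, hδ, fun M _ hLM n hn p q => H M hLM n hn (hK M n hn) p q⟩

end

end Literature.MathematicalPhysics.QuantumFieldTheory.Balaban1983to89.B5Kernel166Decay
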